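import Summits.AtomisticToContinuum.HydrodynamicLimit.Theorems.RelayRaceLocalityConeLocalisationFlooredGlue
import Summits.AtomisticToContinuum.HydrodynamicLimit.Theorems.RelayRaceLocalityConeLocalisationBubbleReadouts
import Literature.MathematicalPhysics.KineticTheory.HardSphereEulerPrimitiveForm
import HarnessLib

/-!
# RelayRaceLocality · ConeLocalisation — the gap is ONE hypothesis on the INITIAL datum

Support file for the crux item `stmt-AtomisticToContinuum-12504` (`ConeLocalisation`, route RelayRaceLocality of
`AtomisticToContinuum/HydrodynamicLimit`), line lead c4 (prover-line-stmt-AtomisticToContinuum-12504-c4-0,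
2026-08-17), on top of the LANDED floored crux
`ConeLocalisation.coneLocalisationFloored_holds : ConeLocalisationFloored` (p137065, line `Sketch`) and the floored
glue (p139719).

Write `A := LightConeInLaw`, `B := NearConstantShortTimeHL`, `S` := the short-time guarded hydrodynamic limit
(consequent of `ConeLocalisation` as typed; NO density floor), `S♭ := ShortTimeGuardedHLFloored` (`S` with the guard
`M⁻¹ ≤ ρ s x` on the whole slab `[0, t]`), and `S₀` := `S` with ONE extra hypothesis, a floor on the INITIAL density
only, `(∀ x, M⁻¹ ≤ ρ 0 x)`, inserted before `∀ t ∈ Ico 0 (min T τ₁)` (every guard on `[0, t]` exactly as typed).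
This file proves, kernel-checked:

* `abs_density_sub_initial_le` — DENSITY DRIFT from the mass equation alone (no equation of state, no floor):
  along a classical hard-sphere Euler solution, if `0 < ρ ≤ M`, `‖u‖ ≤ M`, `|∂ᵢρ| ≤ M`, `‖∂ᵢu‖ ≤ M` on `[0, t) × 𝕋³`
  then `|ρ(t, x) - ρ(0, x)| ≤ 6 M² t` (`∂ₜρ = -Σᵢ (ρ ∂ᵢuᵢ + ∂ᵢρ uᵢ)`, mean value inequality);
* `shortTimeGuardedHLInitiallyFloored_of_floored : S♭ → S₀` — an initial floor `M⁻¹` survives as the floor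
  `(2M)⁻¹` up to time `1/(12 M³)` under the level-`M` guards, so `S♭` at level `2M` applies
  (`τ₁⁰(M) := min (τ₁♭(2M)) (1/(12 M³))`);
* `stub_initiallyFloored` (registered stub of the line `Sketch`, skeleton v4) =
  `coneLocalisationInitiallyFloored_holds : A → B → S₀` — hence the two antecedents of the crux DO deliver `S`
  for every datum whose initial density is bounded below by `M⁻¹`;
* `coneLocalisation_iff_initialFloorRemoval : ConeLocalisation ↔ (A → B → S₀ → S)` — what is left of the item
  as typed is the removal of that single initial-datum hypothesis. For the conjunct's family the initial density is
  pinned by the profile `(a₀, θ₀)` and `σ` (law of large numbers at `t = 0`), which are quantified AFTER `τ₁`: the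
  residual is a quantifier-order artefact of the typed statement (a `τ₁` uniform over arbitrarily deep density
  troughs), i.e. the hydrodynamic limit in the deep-trough regime — summit-level
  (`Theorems/ConeLocalisation/Negative/*`, p132898/p132963/p133018);
* `restartPrinciple_of_restartPrincipleInitiallyFloored : (S₀ → G) → RestartPrinciple` and
  `hydrodynamicLimit_of_restartPrincipleInitiallyFloored : A → B → (S₀ → G) → G` (`G := _root_.HydrodynamicLimit`)
  — restating stmt-12504's consequent AND stmt-12503's antecedent as `S₀` (instead of `S♭`) is an equally valid,
  slightly sharper repair: `closes := h₄ (h₅ h₂ h₃)` unchanged, stmt-12504 closed by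
  `coneLocalisationInitiallyFloored_holds`, stmt-12503 weakened only by an initial-datum hypothesis.

Reference for the drift read-out: A. Majda, *Compressible Fluid Flow and Systems of Conservation Laws in Several
Space Variables* (1984), Ch. 2 (reading `‖∂ₜU‖_{L^∞}` off the equations).
-/

noncomputable section

namespace Summit.AtomisticToContinuum.HydrodynamicLimit.Theorems.ConeLocalisation

open scoped Topology
open Filter Set MeasureTheory
open Literature.MathematicalPhysics.KineticTheory Literature.Analysis.FluidPDE
  Literature.Analysis.FunctionSpaces
open Summit.AtomisticToContinuum.HydrodynamicLimit.Theses.RelayRaceLocality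

/-! ### Density drift from the mass equation -/

/-- Components are bounded by the Euclidean norm. [folklore] -/
-- adapted from `Literature.Analysis.FluidPDE.CompressibleEuler.abs_apply_le_norm`
private theorem abs_apply_le_norm₀ (v : V3) (i : Fin 3) : |v i| ≤ ‖v‖ := by
  simpa using PiLp.norm_apply_le v i

/-- **Time-derivative bound for the density from the mass equation alone.** Along a classical hard-sphere
Euler solution, at a point `(t, x)` with `ρ ≤ M`, `‖u‖ ≤ M`, `|∂ᵢρ| ≤ M` and `‖∂ᵢu‖ ≤ M`:
`|∂ₜρ(t, x)| ≤ 6 M²` (`∂ₜρ = -Σᵢ (ρ ∂ᵢuᵢ + ∂ᵢρ uᵢ)`; no equation of state and no density floor enter).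
[folklore] -/
theorem abs_timeDerivWithin_density_le {σ T M : ℝ} {ρ θ : ℝ → T3 → ℝ} {u : ℝ → T3 → V3}
    (hE : IsHardSphereEulerSolution σ T ρ u θ) (hM : 0 < M) {t : ℝ} (ht : t ∈ Ico 0 T) (x : T3)
    (hρ : ρ t x ≤ M) (hu : ‖u t x‖ ≤ M) (hdρ : ∀ i : Fin 3, |Torus.partialDeriv i (ρ t) x| ≤ M)
    (hdu : ∀ i : Fin 3, ‖Torus.partialDeriv i (u t) x‖ ≤ M) :
    |Torus.timeDerivWithin (Ico 0 T) ρ t x| ≤ 6 * M ^ 2 := by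
  have hρpos : 0 < ρ t x := hE.density_pos t ht x
  have hu1 : Torus.IsContDiff 1 (u t) :=
    (hE.smooth_velocity.isSmooth_slice ht).isContDiff (by simp)
  have hui : ∀ i, |u t x i| ≤ M := fun i => (abs_apply_le_norm₀ _ i).trans hu
  have hdui : ∀ i, |Torus.partialDeriv i (fun y => u t y i) x| ≤ M := fun i => by
    rw [Torus.partialDeriv_apply_coord hu1 i x i]
    exact (abs_apply_le_norm₀ _ i).trans (hdu i)
  rw [hE.timeDeriv_density_eq ht x, abs_neg]
  refine (Finset.abs_sum_le_sum_abs _ _).trans ?_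
  calc ∑ i, |ρ t x * Torus.partialDeriv i (fun y => u t y i) x + Torus.partialDeriv i (ρ t) x * u t x i|
      ≤ ∑ _i : Fin 3, (M * M + M * M) :=
        Finset.sum_le_sum fun i _ => by
          refine (abs_add_le _ _).trans (add_le_add ?_ ?_)
          · rw [abs_mul, abs_of_pos hρpos]
            exact mul_le_mul hρ (hdui i) (abs_nonneg _) hM.le
          · rw [abs_mul]
            exact mul_le_mul (hdρ i) (hui i) (abs_nonneg _) hM.le
    _ = 6 * M ^ 2 := by
        simp only [Finset.sum_const, Finset.card_univ, Fintype.card_fin, nsmul_eq_mul, Nat.cast_ofNat]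
        ring

/-- **Density drift** (mass equation + mean value inequality): along a classical hard-sphere Euler solution on
`[0, T)`, if `ρ ≤ M`, `‖u‖ ≤ M`, `|∂ᵢρ| ≤ M`, `‖∂ᵢu‖ ≤ M` on the slab `[0, t) × 𝕋³` (`t < T`), then
`|ρ(t, x) - ρ(0, x)| ≤ 6 M² t` for every `x`. No equation of state and no density floor enter. [folklore] -/
theorem abs_density_sub_initial_le {σ T M : ℝ} {ρ θ : ℝ → T3 → ℝ} {u : ℝ → T3 → V3}
    (hE : IsHardSphereEulerSolution σ T ρ u θ) (hM : 0 < M) {t : ℝ} (ht : t ∈ Ico 0 T)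
    (hg : ∀ s ∈ Ico 0 t, ∀ x, ρ s x ≤ M ∧ ‖u s x‖ ≤ M ∧
      ∀ i : Fin 3, |Torus.partialDeriv i (ρ s) x| ≤ M ∧ ‖Torus.partialDeriv i (u s) x‖ ≤ M)
    (x : T3) : |ρ t x - ρ 0 x| ≤ 6 * M ^ 2 * t := by
  have h := Bubble.norm_sub_le_of_timeDerivWithin_le (R := 6 * M ^ 2) hE.smooth_density ht x
    fun s hs => by
      rw [Real.norm_eq_abs]
      have hsT : s ∈ Ico 0 T := ⟨hs.1, hs.2.trans ht.2⟩
      obtain ⟨g1, g2, g3⟩ := hg s hs x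
      exact abs_timeDerivWithin_density_le hE hM hsT x g1 g2 (fun i => (g3 i).1) fun i => (g3 i).2
  rwa [Real.norm_eq_abs] at h

/-- **Propagation of an initial density floor.** Under the level-`M` guards `ρ ≤ M`, `‖u‖ ≤ M`, `|∂ᵢρ| ≤ M`,
`‖∂ᵢu‖ ≤ M` on `[0, t) × 𝕋³`, an initial floor `M⁻¹ ≤ ρ(0, ·)` gives `(2M)⁻¹ ≤ ρ(t, x)` as long as
`t ≤ 1 / (12 M³)`. [folklore] -/
theorem initialFloor_propagates {σ T M : ℝ} {ρ θ : ℝ → T3 → ℝ} {u : ℝ → T3 → V3}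
    (hE : IsHardSphereEulerSolution σ T ρ u θ) (hM : 0 < M) {t : ℝ} (ht : t ∈ Ico 0 T)
    (htM : t ≤ 1 / (12 * M ^ 3)) (h0 : ∀ x, M⁻¹ ≤ ρ 0 x)
    (hg : ∀ s ∈ Ico 0 t, ∀ x, ρ s x ≤ M ∧ ‖u s x‖ ≤ M ∧
      ∀ i : Fin 3, |Torus.partialDeriv i (ρ s) x| ≤ M ∧ ‖Torus.partialDeriv i (u s) x‖ ≤ M)
    (x : T3) : (2 * M)⁻¹ ≤ ρ t x := by
  have hdrift := abs_density_sub_initial_le hE hM ht hg x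
  have hlow : ρ 0 x - 6 * M ^ 2 * t ≤ ρ t x := by
    have := neg_abs_le (ρ t x - ρ 0 x)
    linarith
  have hM3 : 0 < 12 * M ^ 3 := by positivity
  have h6 : 6 * M ^ 2 * t ≤ (2 * M)⁻¹ := by
    calc 6 * M ^ 2 * t ≤ 6 * M ^ 2 * (1 / (12 * M ^ 3)) :=
          mul_le_mul_of_nonneg_left htM (by positivity)
      _ = (2 * M)⁻¹ := by field_simp; ring
  have hinv : M⁻¹ = (2 * M)⁻¹ + (2 * M)⁻¹ := by field_simp; ring
  have := h0 x
  linarith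

/-! ### `S♭ → S₀`: the slab floor is implied by an initial floor for short times -/

/-- **`S♭ → S₀`.** The short-time guarded hydrodynamic limit with the density floor on the whole slab `[0, t]`
(`ShortTimeGuardedHLFloored`, PROVED from the two antecedents: p137065) implies the version in which the floor is
asked of the INITIAL density only — `S` as typed plus the single hypothesis `∀ x, M⁻¹ ≤ ρ 0 x` — with
`τ₁⁰(M) := min (τ₁♭(2M)) (1 / (12 M³))`: by `initialFloor_propagates` the level-`M` guards keep the density above
`(2M)⁻¹` up to time `1/(12 M³)`, and every other level-`M` guard is a level-`2M` guard. [folklore] -/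
theorem shortTimeGuardedHLInitiallyFloored_of_floored (h : ShortTimeGuardedHLFloored) :
    ∃ η₀ : ℝ, 0 < η₀ ∧ ∀ M : ℝ, 0 < M → ∃ τ₁ : ℝ, 0 < τ₁ ∧ ∀ (a₀ θ₀ : T3 → ℝ) (u₀ : T3 → V3), Continuous
      a₀ → Continuous θ₀ → Continuous u₀ → (∀ x, 0 < a₀ x) → (∀ x, 0 < θ₀ x) → ∃ σ₀ : ℝ, 0 < σ₀ ∧ ∀ σ : ℝ, 0
      < σ → σ < σ₀ → ∀ (T : ℝ) (ρ θ : ℝ → T3 → ℝ) (u : ℝ → T3 → V3), IsHardSphereEulerSolution σ T ρ u θ → ∀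
      Φ : (N : ℕ) → HardSphereFlow (Torus.geometry (Fin 3)) (hsDiameter σ N) (N + 1), TendstoHydroFieldsAt
      (fun N => localGibbsLaw σ a₀ u₀ θ₀ N (Φ N)) Φ ρ u θ 0 → (∀ x, M⁻¹ ≤ ρ 0 x) →
      ∀ t ∈ Set.Ico 0 (min T τ₁), (∀ s ∈ Set.Icc 0
      t, ∀ x, ρ s x * σ ^ 3 < η₀ ∧ ρ s x ≤ M ∧ θ s x ≤ M ∧ M⁻¹ ≤ θ s x ∧ ‖u s x‖ ≤ M ∧ ∀ i j k : Fin 3,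
      |Torus.partialDeriv i (ρ s) x| ≤ M ∧ ‖Torus.partialDeriv i (u s) x‖ ≤ M ∧ |Torus.partialDeriv i (θ s)
      x| ≤ M ∧ |Torus.partialDeriv i (Torus.partialDeriv j (ρ s)) x| ≤ M ∧ ‖Torus.partialDeriv i
      (Torus.partialDeriv j (u s)) x‖ ≤ M ∧ |Torus.partialDeriv i (Torus.partialDeriv j (θ s)) x| ≤ M ∧
      |Torus.partialDeriv i (Torus.partialDeriv j (Torus.partialDeriv k (ρ s))) x| ≤ M ∧ ‖Torus.partialDeriv
      i (Torus.partialDeriv j (Torus.partialDeriv k (u s))) x‖ ≤ M ∧ |Torus.partialDeriv i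
      (Torus.partialDeriv j (Torus.partialDeriv k (θ s))) x| ≤ M) → TendstoHydroFieldsAt (fun N =>
      localGibbsLaw σ a₀ u₀ θ₀ N (Φ N)) Φ ρ u θ t := by
  obtain ⟨η₀, hη₀, H⟩ := h
  refine ⟨η₀, hη₀, fun M hM => ?_⟩
  have h2M : 0 < 2 * M := by positivity
  obtain ⟨τ₁, hτ₁, H1⟩ := H (2 * M) h2M
  have hτ : 0 < min τ₁ (1 / (12 * M ^ 3)) := lt_min hτ₁ (by positivity)
  refine ⟨min τ₁ (1 / (12 * M ^ 3)), hτ, fun a₀ θ₀ u₀ ha hθ hu ha0 hθ0 => ?_⟩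
  obtain ⟨σ₀, hσ₀, H2⟩ := H1 a₀ θ₀ u₀ ha hθ hu ha0 hθ0
  refine ⟨σ₀, hσ₀, fun σ hσ hσ' T ρ θ u hE Φ hL0 hfloor t ht hg => ?_⟩
  -- `t < min T (min τ₁ (1/(12M³)))`
  have htT : t < T := lt_of_lt_of_le ht.2 (min_le_left _ _)
  have htτ : t < τ₁ := lt_of_lt_of_le ht.2 ((min_le_right _ _).trans (min_le_left _ _))
  have ht12 : t ≤ 1 / (12 * M ^ 3) :=
    (lt_of_lt_of_le ht.2 ((min_le_right _ _).trans (min_le_right _ _))).le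
  have ht' : t ∈ Set.Ico 0 (min T τ₁) := ⟨ht.1, lt_min htT htτ⟩
  have hMle : M ≤ 2 * M := by linarith
  have hMinv : (2 * M)⁻¹ ≤ M⁻¹ := by
    rw [inv_le_inv₀ h2M hM]; exact hMle
  -- the floor `(2M)⁻¹ ≤ ρ s x` on `[0, t]` by drift from the initial floor
  have hfl : ∀ s ∈ Set.Icc 0 t, ∀ x, (2 * M)⁻¹ ≤ ρ s x := by
    intro s hs x
    have hsT : s ∈ Ico 0 T := ⟨hs.1, hs.2.trans_lt htT⟩
    refine initialFloor_propagates hE hM hsT (hs.2.trans ht12) hfloor (fun r hr y => ?_) x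
    have hr' : r ∈ Set.Icc 0 t := ⟨hr.1, (hr.2.le.trans hs.2)⟩
    obtain ⟨-, g2, -, -, g5, g6⟩ := hg r hr' y
    exact ⟨g2, g5, fun i => ⟨(g6 i i i).1, (g6 i i i).2.1⟩⟩
  refine H2 σ hσ hσ' T ρ θ u hE Φ hL0 t ht' fun s hs x => ?_
  obtain ⟨g1, g2, g3, g4, g5, g6⟩ := hg s hs x
  refine ⟨g1, g2.trans hMle, hfl s hs x, g3.trans hMle, hMinv.trans g4, g5.trans hMle, fun i j k => ?_⟩
  obtain ⟨d1, d2, d3, d4, d5, d6, d7, d8, d9⟩ := g6 i j k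
  exact ⟨d1.trans hMle, d2.trans hMle, d3.trans hMle, d4.trans hMle, d5.trans hMle, d6.trans hMle,
    d7.trans hMle, d8.trans hMle, d9.trans hMle⟩

/-! ### The crux with the initial floor, and the glue -/

/-- **STUB `stub_initiallyFloored` of the line `Sketch` (skeleton v4, registered on stmt-AtomisticToContinuum-12504):
`A → B → S₀` — the two antecedents of `ConeLocalisation` deliver the short-time guarded hydrodynamic limit for every
datum with an initial density floor `M⁻¹`.** (`coneLocalisationFloored_holds`, p137065, and
`shortTimeGuardedHLInitiallyFloored_of_floored`.) [folklore] -/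
theorem stub_initiallyFloored :
    LightConeInLaw → NearConstantShortTimeHL →
      (∃ η₀ : ℝ, 0 < η₀ ∧ ∀ M : ℝ, 0 < M → ∃ τ₁ : ℝ, 0 < τ₁ ∧ ∀ (a₀ θ₀ : T3 → ℝ) (u₀ : T3 → V3), Continuous
      a₀ → Continuous θ₀ → Continuous u₀ → (∀ x, 0 < a₀ x) → (∀ x, 0 < θ₀ x) → ∃ σ₀ : ℝ, 0 < σ₀ ∧ ∀ σ : ℝ, 0
      < σ → σ < σ₀ → ∀ (T : ℝ) (ρ θ : ℝ → T3 → ℝ) (u : ℝ → T3 → V3), IsHardSphereEulerSolution σ T ρ u θ → ∀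
      Φ : (N : ℕ) → HardSphereFlow (Torus.geometry (Fin 3)) (hsDiameter σ N) (N + 1), TendstoHydroFieldsAt
      (fun N => localGibbsLaw σ a₀ u₀ θ₀ N (Φ N)) Φ ρ u θ 0 → (∀ x, M⁻¹ ≤ ρ 0 x) →
      ∀ t ∈ Set.Ico 0 (min T τ₁), (∀ s ∈ Set.Icc 0
      t, ∀ x, ρ s x * σ ^ 3 < η₀ ∧ ρ s x ≤ M ∧ θ s x ≤ M ∧ M⁻¹ ≤ θ s x ∧ ‖u s x‖ ≤ M ∧ ∀ i j k : Fin 3,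
      |Torus.partialDeriv i (ρ s) x| ≤ M ∧ ‖Torus.partialDeriv i (u s) x‖ ≤ M ∧ |Torus.partialDeriv i (θ s)
      x| ≤ M ∧ |Torus.partialDeriv i (Torus.partialDeriv j (ρ s)) x| ≤ M ∧ ‖Torus.partialDeriv i
      (Torus.partialDeriv j (u s)) x‖ ≤ M ∧ |Torus.partialDeriv i (Torus.partialDeriv j (θ s)) x| ≤ M ∧
      |Torus.partialDeriv i (Torus.partialDeriv j (Torus.partialDeriv k (ρ s))) x| ≤ M ∧ ‖Torus.partialDeriv
      i (Torus.partialDeriv j (Torus.partialDeriv k (u s))) x‖ ≤ M ∧ |Torus.partialDeriv i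
      (Torus.partialDeriv j (Torus.partialDeriv k (θ s))) x| ≤ M) → TendstoHydroFieldsAt (fun N =>
      localGibbsLaw σ a₀ u₀ θ₀ N (Φ N)) Φ ρ u θ t) :=
  fun hA hB => shortTimeGuardedHLInitiallyFloored_of_floored (coneLocalisationFloored_holds hA hB)

/-- **`A → B → S₀`** (named form of `stub_initiallyFloored`, for the restatement kit): the two antecedents of
`ConeLocalisation` deliver the short-time guarded hydrodynamic limit for every datum with an initial density floor
`M⁻¹`. [folklore] -/
theorem coneLocalisationInitiallyFloored_holds (hA : LightConeInLaw) (hB : NearConstantShortTimeHL) :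
    ∃ η₀ : ℝ, 0 < η₀ ∧ ∀ M : ℝ, 0 < M → ∃ τ₁ : ℝ, 0 < τ₁ ∧ ∀ (a₀ θ₀ : T3 → ℝ) (u₀ : T3 → V3), Continuous
      a₀ → Continuous θ₀ → Continuous u₀ → (∀ x, 0 < a₀ x) → (∀ x, 0 < θ₀ x) → ∃ σ₀ : ℝ, 0 < σ₀ ∧ ∀ σ : ℝ, 0
      < σ → σ < σ₀ → ∀ (T : ℝ) (ρ θ : ℝ → T3 → ℝ) (u : ℝ → T3 → V3), IsHardSphereEulerSolution σ T ρ u θ → ∀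
      Φ : (N : ℕ) → HardSphereFlow (Torus.geometry (Fin 3)) (hsDiameter σ N) (N + 1), TendstoHydroFieldsAt
      (fun N => localGibbsLaw σ a₀ u₀ θ₀ N (Φ N)) Φ ρ u θ 0 → (∀ x, M⁻¹ ≤ ρ 0 x) →
      ∀ t ∈ Set.Ico 0 (min T τ₁), (∀ s ∈ Set.Icc 0
      t, ∀ x, ρ s x * σ ^ 3 < η₀ ∧ ρ s x ≤ M ∧ θ s x ≤ M ∧ M⁻¹ ≤ θ s x ∧ ‖u s x‖ ≤ M ∧ ∀ i j k : Fin 3,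
      |Torus.partialDeriv i (ρ s) x| ≤ M ∧ ‖Torus.partialDeriv i (u s) x‖ ≤ M ∧ |Torus.partialDeriv i (θ s)
      x| ≤ M ∧ |Torus.partialDeriv i (Torus.partialDeriv j (ρ s)) x| ≤ M ∧ ‖Torus.partialDeriv i
      (Torus.partialDeriv j (u s)) x‖ ≤ M ∧ |Torus.partialDeriv i (Torus.partialDeriv j (θ s)) x| ≤ M ∧
      |Torus.partialDeriv i (Torus.partialDeriv j (Torus.partialDeriv k (ρ s))) x| ≤ M ∧ ‖Torus.partialDeriv
      i (Torus.partialDeriv j (Torus.partialDeriv k (u s))) x‖ ≤ M ∧ |Torus.partialDeriv i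
      (Torus.partialDeriv j (Torus.partialDeriv k (θ s))) x| ≤ M) → TendstoHydroFieldsAt (fun N =>
      localGibbsLaw σ a₀ u₀ θ₀ N (Φ N)) Φ ρ u θ t :=
  stub_initiallyFloored hA hB

/-- **What is left of `ConeLocalisation` as typed is the removal of ONE initial-datum hypothesis**:
`ConeLocalisation ↔ (A → B → S₀ → S)`. [folklore] -/
theorem coneLocalisation_iff_initialFloorRemoval :
    ConeLocalisation ↔
    (LightConeInLaw → NearConstantShortTimeHL →
      (∃ η₀ : ℝ, 0 < η₀ ∧ ∀ M : ℝ, 0 < M → ∃ τ₁ : ℝ, 0 < τ₁ ∧ ∀ (a₀ θ₀ : T3 → ℝ) (u₀ : T3 → V3), Continuous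
      a₀ → Continuous θ₀ → Continuous u₀ → (∀ x, 0 < a₀ x) → (∀ x, 0 < θ₀ x) → ∃ σ₀ : ℝ, 0 < σ₀ ∧ ∀ σ : ℝ, 0
      < σ → σ < σ₀ → ∀ (T : ℝ) (ρ θ : ℝ → T3 → ℝ) (u : ℝ → T3 → V3), IsHardSphereEulerSolution σ T ρ u θ → ∀
      Φ : (N : ℕ) → HardSphereFlow (Torus.geometry (Fin 3)) (hsDiameter σ N) (N + 1), TendstoHydroFieldsAt
      (fun N => localGibbsLaw σ a₀ u₀ θ₀ N (Φ N)) Φ ρ u θ 0 → (∀ x, M⁻¹ ≤ ρ 0 x) →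
      ∀ t ∈ Set.Ico 0 (min T τ₁), (∀ s ∈ Set.Icc 0
      t, ∀ x, ρ s x * σ ^ 3 < η₀ ∧ ρ s x ≤ M ∧ θ s x ≤ M ∧ M⁻¹ ≤ θ s x ∧ ‖u s x‖ ≤ M ∧ ∀ i j k : Fin 3,
      |Torus.partialDeriv i (ρ s) x| ≤ M ∧ ‖Torus.partialDeriv i (u s) x‖ ≤ M ∧ |Torus.partialDeriv i (θ s)
      x| ≤ M ∧ |Torus.partialDeriv i (Torus.partialDeriv j (ρ s)) x| ≤ M ∧ ‖Torus.partialDeriv i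
      (Torus.partialDeriv j (u s)) x‖ ≤ M ∧ |Torus.partialDeriv i (Torus.partialDeriv j (θ s)) x| ≤ M ∧
      |Torus.partialDeriv i (Torus.partialDeriv j (Torus.partialDeriv k (ρ s))) x| ≤ M ∧ ‖Torus.partialDeriv
      i (Torus.partialDeriv j (Torus.partialDeriv k (u s))) x‖ ≤ M ∧ |Torus.partialDeriv i
      (Torus.partialDeriv j (Torus.partialDeriv k (θ s))) x| ≤ M) → TendstoHydroFieldsAt (fun N =>
      localGibbsLaw σ a₀ u₀ θ₀ N (Φ N)) Φ ρ u θ t) →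
      (∃ η₀ : ℝ, 0 < η₀ ∧ ∀ M : ℝ, 0 < M → ∃ τ₁ : ℝ, 0 < τ₁ ∧ ∀ (a₀ θ₀ : T3 → ℝ) (u₀ : T3 → V3), Continuous
      a₀ → Continuous θ₀ → Continuous u₀ → (∀ x, 0 < a₀ x) → (∀ x, 0 < θ₀ x) → ∃ σ₀ : ℝ, 0 < σ₀ ∧ ∀ σ : ℝ, 0
      < σ → σ < σ₀ → ∀ (T : ℝ) (ρ θ : ℝ → T3 → ℝ) (u : ℝ → T3 → V3), IsHardSphereEulerSolution σ T ρ u θ → ∀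
      Φ : (N : ℕ) → HardSphereFlow (Torus.geometry (Fin 3)) (hsDiameter σ N) (N + 1), TendstoHydroFieldsAt
      (fun N => localGibbsLaw σ a₀ u₀ θ₀ N (Φ N)) Φ ρ u θ 0 → ∀ t ∈ Set.Ico 0 (min T τ₁), (∀ s ∈ Set.Icc 0
      t, ∀ x, ρ s x * σ ^ 3 < η₀ ∧ ρ s x ≤ M ∧ θ s x ≤ M ∧ M⁻¹ ≤ θ s x ∧ ‖u s x‖ ≤ M ∧ ∀ i j k : Fin 3,
      |Torus.partialDeriv i (ρ s) x| ≤ M ∧ ‖Torus.partialDeriv i (u s) x‖ ≤ M ∧ |Torus.partialDeriv i (θ s)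
      x| ≤ M ∧ |Torus.partialDeriv i (Torus.partialDeriv j (ρ s)) x| ≤ M ∧ ‖Torus.partialDeriv i
      (Torus.partialDeriv j (u s)) x‖ ≤ M ∧ |Torus.partialDeriv i (Torus.partialDeriv j (θ s)) x| ≤ M ∧
      |Torus.partialDeriv i (Torus.partialDeriv j (Torus.partialDeriv k (ρ s))) x| ≤ M ∧ ‖Torus.partialDeriv
      i (Torus.partialDeriv j (Torus.partialDeriv k (u s))) x‖ ≤ M ∧ |Torus.partialDeriv i
      (Torus.partialDeriv j (Torus.partialDeriv k (θ s))) x| ≤ M) → TendstoHydroFieldsAt (fun N =>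
      localGibbsLaw σ a₀ u₀ θ₀ N (Φ N)) Φ ρ u θ t)) := by
  constructor
  · intro h hA hB _
    exact h hA hB
  · intro h hA hB
    exact h hA hB (coneLocalisationInitiallyFloored_holds hA hB)

/-- **`(S₀ → G) → RestartPrinciple`** (`RestartPrinciple` is literally `S → G`, and `S → S₀` by ignoring the extra
initial-floor hypothesis): restating stmt-12503's antecedent as `S₀` STRENGTHENS the item. [folklore] -/
theorem restartPrinciple_of_restartPrincipleInitiallyFloored
    (h : (∃ η₀ : ℝ, 0 < η₀ ∧ ∀ M : ℝ, 0 < M → ∃ τ₁ : ℝ, 0 < τ₁ ∧ ∀ (a₀ θ₀ : T3 → ℝ) (u₀ : T3 → V3), Continuous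
      a₀ → Continuous θ₀ → Continuous u₀ → (∀ x, 0 < a₀ x) → (∀ x, 0 < θ₀ x) → ∃ σ₀ : ℝ, 0 < σ₀ ∧ ∀ σ : ℝ, 0
      < σ → σ < σ₀ → ∀ (T : ℝ) (ρ θ : ℝ → T3 → ℝ) (u : ℝ → T3 → V3), IsHardSphereEulerSolution σ T ρ u θ → ∀
      Φ : (N : ℕ) → HardSphereFlow (Torus.geometry (Fin 3)) (hsDiameter σ N) (N + 1), TendstoHydroFieldsAt
      (fun N => localGibbsLaw σ a₀ u₀ θ₀ N (Φ N)) Φ ρ u θ 0 → (∀ x, M⁻¹ ≤ ρ 0 x) →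
      ∀ t ∈ Set.Ico 0 (min T τ₁), (∀ s ∈ Set.Icc 0
      t, ∀ x, ρ s x * σ ^ 3 < η₀ ∧ ρ s x ≤ M ∧ θ s x ≤ M ∧ M⁻¹ ≤ θ s x ∧ ‖u s x‖ ≤ M ∧ ∀ i j k : Fin 3,
      |Torus.partialDeriv i (ρ s) x| ≤ M ∧ ‖Torus.partialDeriv i (u s) x‖ ≤ M ∧ |Torus.partialDeriv i (θ s)
      x| ≤ M ∧ |Torus.partialDeriv i (Torus.partialDeriv j (ρ s)) x| ≤ M ∧ ‖Torus.partialDeriv i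
      (Torus.partialDeriv j (u s)) x‖ ≤ M ∧ |Torus.partialDeriv i (Torus.partialDeriv j (θ s)) x| ≤ M ∧
      |Torus.partialDeriv i (Torus.partialDeriv j (Torus.partialDeriv k (ρ s))) x| ≤ M ∧ ‖Torus.partialDeriv
      i (Torus.partialDeriv j (Torus.partialDeriv k (u s))) x‖ ≤ M ∧ |Torus.partialDeriv i
      (Torus.partialDeriv j (Torus.partialDeriv k (θ s))) x| ≤ M) → TendstoHydroFieldsAt (fun N =>
      localGibbsLaw σ a₀ u₀ θ₀ N (Φ N)) Φ ρ u θ t) → _root_.HydrodynamicLimit) :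
    RestartPrinciple := by
  intro hS
  refine h ?_
  obtain ⟨η₀, hη₀, H⟩ := hS
  refine ⟨η₀, hη₀, fun M hM => ?_⟩
  obtain ⟨τ₁, hτ₁, H1⟩ := H M hM
  refine ⟨τ₁, hτ₁, fun a₀ θ₀ u₀ ha hθ hu ha0 hθ0 => ?_⟩
  obtain ⟨σ₀, hσ₀, H2⟩ := H1 a₀ θ₀ u₀ ha hθ hu ha0 hθ0
  exact ⟨σ₀, hσ₀, fun σ hσ hσ' T ρ θ u hE Φ h0 _ t ht hg => H2 σ hσ hσ' T ρ θ u hE Φ h0 t ht hg⟩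

/-- **The deciding theorem with `RestartPrinciple`'s antecedent restated as `S₀` needs no `ConeLocalisation`
hypothesis**: `A → B → (S₀ → G) → G`. [folklore] -/
theorem hydrodynamicLimit_of_restartPrincipleInitiallyFloored (h₂ : LightConeInLaw)
    (h₃ : NearConstantShortTimeHL)
    (h₄ : (∃ η₀ : ℝ, 0 < η₀ ∧ ∀ M : ℝ, 0 < M → ∃ τ₁ : ℝ, 0 < τ₁ ∧ ∀ (a₀ θ₀ : T3 → ℝ) (u₀ : T3 → V3), Continuous
      a₀ → Continuous θ₀ → Continuous u₀ → (∀ x, 0 < a₀ x) → (∀ x, 0 < θ₀ x) → ∃ σ₀ : ℝ, 0 < σ₀ ∧ ∀ σ : ℝ, 0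
      < σ → σ < σ₀ → ∀ (T : ℝ) (ρ θ : ℝ → T3 → ℝ) (u : ℝ → T3 → V3), IsHardSphereEulerSolution σ T ρ u θ → ∀
      Φ : (N : ℕ) → HardSphereFlow (Torus.geometry (Fin 3)) (hsDiameter σ N) (N + 1), TendstoHydroFieldsAt
      (fun N => localGibbsLaw σ a₀ u₀ θ₀ N (Φ N)) Φ ρ u θ 0 → (∀ x, M⁻¹ ≤ ρ 0 x) →
      ∀ t ∈ Set.Ico 0 (min T τ₁), (∀ s ∈ Set.Icc 0
      t, ∀ x, ρ s x * σ ^ 3 < η₀ ∧ ρ s x ≤ M ∧ θ s x ≤ M ∧ M⁻¹ ≤ θ s x ∧ ‖u s x‖ ≤ M ∧ ∀ i j k : Fin 3,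
      |Torus.partialDeriv i (ρ s) x| ≤ M ∧ ‖Torus.partialDeriv i (u s) x‖ ≤ M ∧ |Torus.partialDeriv i (θ s)
      x| ≤ M ∧ |Torus.partialDeriv i (Torus.partialDeriv j (ρ s)) x| ≤ M ∧ ‖Torus.partialDeriv i
      (Torus.partialDeriv j (u s)) x‖ ≤ M ∧ |Torus.partialDeriv i (Torus.partialDeriv j (θ s)) x| ≤ M ∧
      |Torus.partialDeriv i (Torus.partialDeriv j (Torus.partialDeriv k (ρ s))) x| ≤ M ∧ ‖Torus.partialDeriv
      i (Torus.partialDeriv j (Torus.partialDeriv k (u s))) x‖ ≤ M ∧ |Torus.partialDeriv i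
      (Torus.partialDeriv j (Torus.partialDeriv k (θ s))) x| ≤ M) → TendstoHydroFieldsAt (fun N =>
      localGibbsLaw σ a₀ u₀ θ₀ N (Φ N)) Φ ρ u θ t) → _root_.HydrodynamicLimit) :
    _root_.HydrodynamicLimit :=
  h₄ (coneLocalisationInitiallyFloored_holds h₂ h₃)

end Summit.AtomisticToContinuum.HydrodynamicLimit.Theorems.ConeLocalisation

end
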